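import Mathlib

/-!
# The blind-cube identity: `(1 − |a∩b|)² + λ|a|·|aΔP|` has nonnegative rank `≤ 2n² + 3n + 2`
(crux `FifoMatching.NNDivisionHard`, stmt-ValiantsHypothesis-21181; Negative lane)

val-idea-39 g3 (b139 W5-P1), workfile `Cruxes/NNDivisionHard/CliqueRowBlind.lean` rev 6 §2, critic of record
val-idea-crit-9 g1 (VERDICT #29: KEEP; price P-P1b «land the refutation of the realizable clique-row law in the Negative
lane»).  This file is the pure-matrix half of that refutation: for every `n` and every integer `λ ≥ max(1, n − 1)` the
`2ⁿ × (2ⁿ·2ⁿ)` matrix `M_λ(a;(b,P)) = (1 − |a∩b|)² + λ·|a|·|aΔP|` — which IS the augmented clique-row slack matrix of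
`COR(n) + λ•Q♮` for the blind affine cube `Q♮` (`⟨udRow a, q_P⟩ = −|a|·|aΔP|`, workfile §1) — is an explicit sum of
`|BIdx n| = 2n² + 3n + 2` products of NONNEGATIVE row and column functions (`blind_identity`, `blindRow_nonneg`,
`blindCol_nonneg`, `blind_rankPlus_le`).  Consequently no value-level certificate on the clique-row slack (rank₊,
corruption / PROP R, lifted N9) can exceed `O(n²)` there, although `xc(COR(n) + λQ♮) + 1 ≥ 1.5^{n−1}` (workfile §3): the
realizable clique-row law P1 is false (the polytope-level statement `cliqueRowsLaw_false` is the companion file).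
The identity is a polynomial identity in the 0/1 indicators `X = 𝟙_a`, `Y = 𝟙_b`, `p = 𝟙_P` using only `X_i² = X_i`;
seven slot families, all factors integers.  Theorems and concrete data only; VP ≠ VNP is NOT proved; the crux stays OPEN.
-/

namespace Summit.ValiantsHypothesis.Theorems.NNDivisionHardNegative.BlindCubeIdentity

open Finset

/-! ## §2 The explicit nonnegative factorization of `M_λ(a;(b,P)) = (1 − |a∩b|)² + λ|a||aΔP|`

Index type (7 families): `[a = ∅] · 1`, `[a ≠ ∅] · (1 − |P∩b|)²`, and for `i, m : Fin n`
`X_iX_m · (1−P_i)(λ + Y_iY_m)` (`m ≠ i`), `X_i · (1−P_i)(λ + Y_i(p−1))`, `(1−X_i)X_m · P_i(λ − Y_iY_m − Y_i(p−2)₊)` (`m ≠ i`),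
`(1−X_i)(|a|−1)₊ · P_iY_i(p−2)₊`, `(1−X_i)[a ≠ ∅] · P_iY_i(2−p)₊`, where `X = 𝟙_a, Y = 𝟙_b, p = |P ∩ b|`.
All factors are integers; we state them over `ℤ` and cast. -/

/-- index type of the factorization: `2 + n² + n + n² + n + n = 2n² + 3n + 2` terms (diagonal `(i,i)` slots carry `0`). -/
abbrev BIdx (n : ℕ) := (Fin 2) ⊕ (Fin n × Fin n) ⊕ Fin n ⊕ (Fin n × Fin n) ⊕ Fin n ⊕ Fin n

/-- helper (card_BIdx): see the module docstring; part of the blind-cube factorization. -/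
theorem card_BIdx (n : ℕ) : Fintype.card (BIdx n) = 2 * n ^ 2 + 3 * n + 2 := by
  simp [BIdx, Fintype.card_sum, Fintype.card_prod, Fintype.card_fin]; ring

section IntCore
variable {n : ℕ}

/-- indicator as an integer -/
def ind (a : Finset (Fin n)) (i : Fin n) : ℤ := if i ∈ a then 1 else 0

/-- row factors `U(a, idx) ≥ 0` -/
def blindRow (a : Finset (Fin n)) : BIdx n → ℤ
  | Sum.inl k => if k = 0 then (if a = ∅ then 1 else 0) else (if a = ∅ then 0 else 1)
  | Sum.inr (Sum.inl (i, m)) => if i = m then 0 else ind a i * ind a m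
  | Sum.inr (Sum.inr (Sum.inl i)) => ind a i
  | Sum.inr (Sum.inr (Sum.inr (Sum.inl (i, m)))) => if i = m then 0 else (1 - ind a i) * ind a m
  | Sum.inr (Sum.inr (Sum.inr (Sum.inr (Sum.inl i)))) => (1 - ind a i) * max ((a.card : ℤ) - 1) 0
  | Sum.inr (Sum.inr (Sum.inr (Sum.inr (Sum.inr i)))) => (1 - ind a i) * (if a = ∅ then 0 else 1)

/-- column factors `V((b,P), idx) ≥ 0` for `λ ≥ n − 1` (`p = |P ∩ b|`) -/
def blindCol (lam : ℤ) (b P : Finset (Fin n)) : BIdx n → ℤ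
  | Sum.inl k => if k = 0 then 1 else (1 - ((P ∩ b).card : ℤ)) ^ 2
  | Sum.inr (Sum.inl (i, m)) => (1 - ind P i) * (lam + ind b i * ind b m)
  | Sum.inr (Sum.inr (Sum.inl i)) => (1 - ind P i) * (lam + ind b i * (((P ∩ b).card : ℤ) - 1))
  | Sum.inr (Sum.inr (Sum.inr (Sum.inl (i, m)))) =>
      ind P i * (lam - ind b i * ind b m - ind b i * max (((P ∩ b).card : ℤ) - 2) 0)
  | Sum.inr (Sum.inr (Sum.inr (Sum.inr (Sum.inl i)))) => ind P i * ind b i * max (((P ∩ b).card : ℤ) - 2) 0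
  | Sum.inr (Sum.inr (Sum.inr (Sum.inr (Sum.inr i)))) => ind P i * ind b i * max (2 - ((P ∩ b).card : ℤ)) 0

/-- the target entry `(1 − |a∩b|)² + λ|a||aΔP|` over `ℤ` -/
def blindLHS (lam : ℤ) (a b P : Finset (Fin n)) : ℤ :=
  (1 - ((a ∩ b).card : ℤ)) ^ 2 + lam * (a.card * (a.card + P.card - 2 * ((a ∩ P).card : ℤ)))

/-- helper (ind_nonneg): see the module docstring; part of the blind-cube factorization. -/
theorem ind_nonneg (a : Finset (Fin n)) (i : Fin n) : 0 ≤ ind a i := by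
  unfold ind; split_ifs <;> norm_num

/-- helper (ind_le_one): see the module docstring; part of the blind-cube factorization. -/
theorem ind_le_one (a : Finset (Fin n)) (i : Fin n) : ind a i ≤ 1 := by
  unfold ind; split_ifs <;> norm_num

/-- helper (blindRow_nonneg): see the module docstring; part of the blind-cube factorization. -/
theorem blindRow_nonneg (a : Finset (Fin n)) (idx : BIdx n) : 0 ≤ blindRow a idx := by
  have h0 := ind_nonneg a; have h1 := ind_le_one a
  rcases idx with k | ⟨i, m⟩ | i | ⟨i, m⟩ | i | i <;> simp only [blindRow]
  · split_ifs <;> norm_num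
  · split_ifs
    · exact le_rfl
    · exact mul_nonneg (h0 i) (h0 m)
  · exact h0 i
  · split_ifs
    · exact le_rfl
    · exact mul_nonneg (by linarith [h1 i]) (h0 m)
  · exact mul_nonneg (by linarith [h1 i]) (le_max_right _ _)
  · exact mul_nonneg (by linarith [h1 i]) (by split_ifs <;> norm_num)

/-- column factors are nonnegative as soon as `λ ≥ max(1, n − 1)`. -/
theorem blindCol_nonneg {lam : ℤ} (hlam1 : 1 ≤ lam) (hlam : (n : ℤ) ≤ lam + 1) (b P : Finset (Fin n))
    (idx : BIdx n) : 0 ≤ blindCol lam b P idx := by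
  have h0 := ind_nonneg (n := n); have h1 := ind_le_one (n := n)
  have hp : ((P ∩ b).card : ℤ) ≤ n := by
    have := Finset.card_le_univ (P ∩ b); rw [Fintype.card_fin] at this; exact_mod_cast this
  have hpc : (0 : ℤ) ≤ ((P ∩ b).card : ℤ) := Nat.cast_nonneg _
  rcases idx with k | ⟨i, m⟩ | i | ⟨i, m⟩ | i | i <;> simp only [blindCol]
  · split_ifs
    · norm_num
    · exact sq_nonneg _
  · exact mul_nonneg (by linarith [h1 P i]) (by nlinarith [h0 b i, h0 b m, h1 b i, h1 b m])
  · exact mul_nonneg (by linarith [h1 P i]) (by nlinarith [mul_nonneg (h0 b i) hpc, h1 b i, h0 b i])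
  · refine mul_nonneg (h0 P i) ?_
    rcases le_or_gt 2 ((P ∩ b).card : ℤ) with h | h
    · rw [max_eq_left (by linarith)]
      nlinarith [h0 b i, h1 b i, h0 b m, h1 b m, mul_nonneg (h0 b i) (h0 b m),
        mul_le_of_le_one_left (show (0:ℤ) ≤ ((P ∩ b).card : ℤ) - 2 by linarith) (h1 b i)]
    · rw [max_eq_right (by linarith)]
      nlinarith [h0 b i, h1 b i, h0 b m, h1 b m, mul_nonneg (h0 b i) (h0 b m)]
  · exact mul_nonneg (mul_nonneg (h0 P i) (h0 b i)) (le_max_right _ _)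
  · exact mul_nonneg (mul_nonneg (h0 P i) (h0 b i)) (le_max_right _ _)

/-- helper (ind_mul_self): see the module docstring; part of the blind-cube factorization. -/
theorem ind_mul_self (a : Finset (Fin n)) (i : Fin n) : ind a i * ind a i = ind a i := by
  unfold ind; split_ifs <;> ring

/-- helper (ind_inter): see the module docstring; part of the blind-cube factorization. -/
theorem ind_inter (a b : Finset (Fin n)) (i : Fin n) : ind a i * ind b i = ind (a ∩ b) i := by
  unfold ind; by_cases ha : i ∈ a <;> by_cases hb : i ∈ b <;> simp [ha, hb]

/-- helper (sum_ind): see the module docstring; part of the blind-cube factorization. -/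
theorem sum_ind (a : Finset (Fin n)) : ∑ i, ind a i = (a.card : ℤ) := by
  classical
  unfold ind
  rw [Finset.sum_boole, Finset.filter_mem_eq_inter, Finset.univ_inter]

/-- helper (sum_ind_mul): see the module docstring; part of the blind-cube factorization. -/
theorem sum_ind_mul (a b : Finset (Fin n)) : ∑ i, ind a i * ind b i = ((a ∩ b).card : ℤ) := by
  simp_rw [ind_inter]; exact sum_ind _

/-- helper (sum_ite_eq_sub): see the module docstring; part of the blind-cube factorization. -/
theorem sum_ite_eq_sub (i : Fin n) (g : Fin n → ℤ) :
    ∑ m, (if i = m then 0 else g m) = ∑ m, g m - g i := by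
  have : ∀ m, (if i = m then 0 else g m) = g m - (if i = m then g m else 0) := by
    intro m; split_ifs <;> ring
  simp_rw [this]
  rw [Finset.sum_sub_distrib, Finset.sum_ite_eq, if_pos (Finset.mem_univ _)]

/-- the six blocks of a sum over `BIdx n` -/
theorem sum_BIdx (f : BIdx n → ℤ) :
    ∑ idx, f idx = (f (Sum.inl 0) + f (Sum.inl 1)) +
      ((∑ i, ∑ m, f (Sum.inr (Sum.inl (i, m)))) +
      ((∑ i, f (Sum.inr (Sum.inr (Sum.inl i)))) +
      ((∑ i, ∑ m, f (Sum.inr (Sum.inr (Sum.inr (Sum.inl (i, m)))))) +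
      ((∑ i, f (Sum.inr (Sum.inr (Sum.inr (Sum.inr (Sum.inl i)))))) +
       (∑ i, f (Sum.inr (Sum.inr (Sum.inr (Sum.inr (Sum.inr i)))))))))) := by
  simp only [Fintype.sum_sum_type, Fintype.sum_prod_type, Fin.sum_univ_two]

/-- ★★ **THE BLINDNESS IDENTITY, ALL `n`, ALL `λ`** (sorry-free, axioms standard):
`(1 − |a∩b|)² + λ|a||aΔP| = Σ_idx blindRow a idx · blindCol λ b P idx`.
Proof = the per-coordinate regrouping of the card (`X_i² = X_i`, `Σ_{m≠i} X_m = k − X_i`, `(2−p)₊ − (p−2)₊ = 2 − p`). -/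
theorem blind_identity (lam : ℤ) (a b P : Finset (Fin n)) :
    blindLHS lam a b P = ∑ idx : BIdx n, blindRow a idx * blindCol lam b P idx := by
  classical
  rw [sum_BIdx]
  simp only [blindRow, blindCol, Fin.isValue, if_true, show ((1 : Fin 2) = 0) = False from eq_false (by decide),
    if_false]
  have hX2 := ind_mul_self a
  have hY2 := ind_mul_self b
  have sX := sum_ind a
  have sP := sum_ind P
  have sXY := sum_ind_mul a b
  have sPY := sum_ind_mul P b
  have sXP := sum_ind_mul a P
  set M1 : ℤ := max (((P ∩ b).card : ℤ) - 2) 0 with hM1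
  set M3 : ℤ := max (2 - ((P ∩ b).card : ℤ)) 0 with hM3
  have hM : M3 = M1 + (2 - ((P ∩ b).card : ℤ)) := by
    rw [hM1, hM3]
    rcases le_total (((P ∩ b).card : ℤ)) 2 with h | h
    · rw [max_eq_left (by linarith), max_eq_right (by linarith)]; ring
    · rw [max_eq_right (by linarith), max_eq_left (by linarith)]; ring
  -- family `X_i X_m (m ≠ i)`: closed form per `i`
  have F1 : ∀ i, ∑ m, (if i = m then 0 else ind a i * ind a m) * ((1 - ind P i) * (lam + ind b i * ind b m)) =
      ind a i * (1 - ind P i) * (lam * ((a.card : ℤ) - 1) + ind b i * (((a ∩ b).card : ℤ) - 1)) := by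
    intro i
    have : ∀ m, (if i = m then 0 else ind a i * ind a m) * ((1 - ind P i) * (lam + ind b i * ind b m)) =
        if i = m then 0 else ind a i * ind a m * ((1 - ind P i) * (lam + ind b i * ind b m)) := by
      intro m; split_ifs <;> ring
    simp_rw [this]
    rw [sum_ite_eq_sub, hX2, hY2]
    have hs : ∑ m, ind a i * ind a m * ((1 - ind P i) * (lam + ind b i * ind b m)) =
        ind a i * (1 - ind P i) * (lam * ∑ m, ind a m + ind b i * ∑ m, ind a m * ind b m) := by
      rw [Finset.mul_sum, Finset.mul_sum, ← Finset.sum_add_distrib, Finset.mul_sum]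
      exact Finset.sum_congr rfl fun m _ => by ring
    rw [hs, sX, sXY]; ring
  -- family `(1 − X_i) X_m (m ≠ i)`: closed form per `i`
  have F3 : ∀ i, ∑ m, (if i = m then 0 else (1 - ind a i) * ind a m) *
        (ind P i * (lam - ind b i * ind b m - ind b i * M1)) =
      (1 - ind a i) * ind P i *
        (lam * (a.card : ℤ) - ind b i * ((a ∩ b).card : ℤ) - ind b i * M1 * (a.card : ℤ)) := by
    intro i
    have : ∀ m, (if i = m then 0 else (1 - ind a i) * ind a m) *
          (ind P i * (lam - ind b i * ind b m - ind b i * M1)) =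
        if i = m then 0 else (1 - ind a i) * ind a m * (ind P i * (lam - ind b i * ind b m - ind b i * M1)) := by
      intro m; split_ifs <;> ring
    simp_rw [this]
    rw [sum_ite_eq_sub]
    have h0 : (1 - ind a i) * ind a i = 0 := by rw [sub_mul, one_mul, hX2, sub_self]
    have hs : ∑ m, (1 - ind a i) * ind a m * (ind P i * (lam - ind b i * ind b m - ind b i * M1)) =
        (1 - ind a i) * ind P i *
          (lam * ∑ m, ind a m - ind b i * ∑ m, ind a m * ind b m - ind b i * M1 * ∑ m, ind a m) := by
      rw [Finset.mul_sum, Finset.mul_sum, Finset.mul_sum, ← Finset.sum_sub_distrib, ← Finset.sum_sub_distrib,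
        Finset.mul_sum]
      exact Finset.sum_congr rfl fun m _ => by ring
    rw [hs, sX, sXY]
    have : (1 - ind a i) * ind a i * (ind P i * (lam - ind b i * ind b i - ind b i * M1)) = 0 := by
      rw [h0, zero_mul]
    rw [this]; ring
  simp_rw [F1, F3]
  rcases eq_or_ne a ∅ with rfl | ha
  · simp [blindLHS, ind]
  · have hk : max ((a.card : ℤ) - 1) 0 = (a.card : ℤ) - 1 := by
      rw [max_eq_left]; have := Finset.card_pos.2 (Finset.nonempty_iff_ne_empty.2 ha); omega
    simp only [ha, if_false, hk, one_mul, zero_add, mul_one]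
    have per : ∀ i,
        ind a i * (1 - ind P i) * (lam * ((a.card : ℤ) - 1) + ind b i * (((a ∩ b).card : ℤ) - 1)) +
        (ind a i * ((1 - ind P i) * (lam + ind b i * (((P ∩ b).card : ℤ) - 1))) +
        ((1 - ind a i) * ind P i * (lam * (a.card : ℤ) - ind b i * ((a ∩ b).card : ℤ) - ind b i * M1 * (a.card : ℤ)) +
        ((1 - ind a i) * ((a.card : ℤ) - 1) * (ind P i * ind b i * M1) +
         (1 - ind a i) * (ind P i * ind b i * M3)))) =
        lam * (a.card : ℤ) * ind a i + lam * (a.card : ℤ) * ind P i - 2 * lam * (a.card : ℤ) * (ind a i * ind P i)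
          + (((a ∩ b).card : ℤ) + ((P ∩ b).card : ℤ) - 2) * (ind a i * ind b i)
          - (((a ∩ b).card : ℤ) + ((P ∩ b).card : ℤ) - 2) * (ind P i * ind b i) := by
      intro i
      rw [hM]
      ring
    rw [← Finset.sum_add_distrib, ← Finset.sum_add_distrib, ← Finset.sum_add_distrib, ← Finset.sum_add_distrib]
    rw [Finset.sum_congr rfl (fun i _ => per i)]
    rw [Finset.sum_sub_distrib, Finset.sum_add_distrib, Finset.sum_sub_distrib, Finset.sum_add_distrib,
      ← Finset.mul_sum, ← Finset.mul_sum, ← Finset.mul_sum, ← Finset.mul_sum, ← Finset.mul_sum,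
      sX, sP, sXP, sXY, sPY, blindLHS]
    ring
end IntCore

/-- ★★ **`rank₊ M_λ ≤ 2n² + 3n + 2`**: for every integer `λ` with `1 ≤ λ` and `n ≤ λ + 1` there are NONNEGATIVE real
`U : Finset (Fin n) → BIdx n → ℝ`, `V : Finset (Fin n) × Finset (Fin n) → BIdx n → ℝ` with
`(1 − |a∩b|)² + λ|a||aΔP| = Σ_idx U a idx · V (b,P) idx` for all `a b P` (`|aΔP| = |a| + |P| − 2|a∩P|`). -/
theorem blind_rankPlus_le (n : ℕ) (lam : ℤ) (hlam1 : 1 ≤ lam) (hlam : (n : ℤ) ≤ lam + 1) :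
    ∃ (U : Finset (Fin n) → BIdx n → ℝ) (V : Finset (Fin n) × Finset (Fin n) → BIdx n → ℝ),
      (∀ a idx, 0 ≤ U a idx) ∧ (∀ bP idx, 0 ≤ V bP idx) ∧
      ∀ a b P : Finset (Fin n),
        ((1 : ℝ) - ((a ∩ b).card : ℝ)) ^ 2
            + (lam : ℝ) * ((a.card : ℝ) * ((a.card : ℝ) + (P.card : ℝ) - 2 * ((a ∩ P).card : ℝ)))
          = ∑ idx, U a idx * V (b, P) idx := by
  refine ⟨fun a idx => (blindRow a idx : ℝ), fun bP idx => (blindCol lam bP.1 bP.2 idx : ℝ),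
    fun a idx => Int.cast_nonneg_iff.mpr (blindRow_nonneg a idx) |>.trans_eq (by simp),
    fun bP idx => Int.cast_nonneg_iff.mpr (blindCol_nonneg hlam1 hlam bP.1 bP.2 idx) |>.trans_eq (by simp), ?_⟩
  intro a b P
  have h := congrArg (fun z : ℤ => (z : ℝ)) (blind_identity lam a b P)
  simp only [blindLHS, Int.cast_add, Int.cast_pow, Int.cast_sub, Int.cast_one, Int.cast_mul, Int.cast_natCast,
    Int.cast_sum] at h
  simpa using h

end Summit.ValiantsHypothesis.Theorems.NNDivisionHardNegative.BlindCubeIdentity
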